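import Summits.QuantumFields.BalabanUV.T4Continuum.Support.NE7AxialRecursionLetters
import Summits.QuantumFields.BalabanUV.T4Continuum.Support.NE7AxialGaugeLattice
import HarnessLib

/-!
# NE7AxialGaugeDerivatives — FIRST AND SECOND LATTICE DIFFERENCES OF THE BOND VARIABLES IN A COMPLETE AXIAL GAUGE, by DESCENDING INDUCTION OVER THE STRATA
# `S_j(y) = {x : x_κ = y_κ, κ < j}`: if the tree bonds are trivial (`x ∈ S_j ⟹ W(x, j) = 1`) and the ONE-STEP PLAQUETTE RECURSION `W(x + e_j, ν) = Q(x; j, ν)·W(x, ν)`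
# holds on `S_j` for `ν > j` (F2 `NE7AxialGaugeStrata.axial_rec`), with `‖W‖, ‖Q‖ ≤ 1`, `‖Q − 1‖ ≤ a`, unit-translation discrepancies `‖Q(· + e_λ) − Q‖ ≤ p₁` and
# mixed second differences `‖Δ_λΔ_λ′Q‖ ≤ p₂` on the region `{y ≤ x, l1(x − y) ≤ R (+1)}`, then on that region
#   `‖W(x + e_λ, ν) − W(x, ν)‖ ≤ d·(R·p₁ + a)`   and   `‖Δ_λΔ_λ′ W(·, ν)(x)‖ ≤ d·(R·(p₂ + 2p₁δ) + p₁ + aδ)`,  `δ = d·((R+1)·p₁ + a)`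
# — NO factor of the bond deviation alone enters the second differences (only `p₁`, `p₂`, `a·δ`): the input of the (9)-TYPE Hölder clause

Cell `pub-balaban`, rung (B)+1 sub-cell t4, lineage `b2b-balaban-t4-ne7-p1` (CRUX PROVER NE7 #1 = OWNER of BINDER row NE7), generation 111.  Memo
`t4/b2b-balaban-t4-ne7-p1-g111/ROAD-G111.md`.  File F3 of the line «(9)-TYPE k-UNIFORM HÖLDER REGULARITY OF EVERY CONSTRAINED SMALL-FIELD MINIMISER, every β < 1»
(ROAD-G110 §NEXT (N2)); over F1 `NE7AxialRecursionLetters` (`seq_firstDiff_le`, `seq_secondDiff_le`); instantiated in F4 `NE7AxialGaugePotential` at `W = U^{v₀}`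
(tree gauge of [Balaban1985Averaging] p. 24 based at `y`), `Q(x; j, ν) = W(∂p_{jν}(x))`.
THE INDUCTION (for a fixed direction `ν`, `j` from `ν` down to `0`; claim at level `j`: the bounds at the points of `S_j` for difference directions `λ, λ′ ≥ j`).
Base `j = ν`: `W(·, ν) ≡ 1` on `S_ν ∋ x, x + e_λ` (`λ ≥ ν`).  Step `j+1 → j` at `x ∈ S_j`: `x = x* + m·e_j`, `x* ∈ S_{j+1}`, `m = x_j − y_j ≤ R`; along the segment
`z_t = x* + t·e_j ⊂ S_j` the recursion reads `g(t+1) = Q(z_t)·g(t)` for `g(t) = W(z_t, ν)` and for its translates by `e_λ`, `e_λ′`, `e_λ + e_λ′` (`λ, λ′ > j` keep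
`S_j`), so F1's sequence letters carry the bound from `x*` (induction hypothesis, directions `≥ j+1`) to `x` at cost `m·p₁` resp. `m·(p₂ + 2p₁δ)`; the direction
`λ = j` itself is the recursion: `W(x + e_j, ν) − W(x, ν) = (Q(x) − 1)·W(x, ν)` and `Δ_jΔ_λ′W = (Q(x + e_λ′) − Q(x))·W(x + e_λ′, ν) + (Q(x) − 1)·Δ_λ′W(x)`.
WHAT ([folklore]; 0 def, 0 sorry; any `d`, any normed ring).  §1 = `NE7AxialGaugeLattice` (feet and segments); §2
**`firstDiff_induction`**, **`norm_firstDiff_le`**; §3 **`secondDiff_induction`**, **`norm_secondDiff_le`**.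
HONEST FRAMING (page 1): elementary lattice analysis under displayed hypotheses (the axial structure is F2's theorem, the plaquette letters are inputs); nothing of
Bałaban's asserted; NOT NE3∕NE7 as spine nodes; spine 0∕9; finite T⁴ rung (B)+1 — NOT infinite volume, NOT mass gap, NOT BetaPertH, NOT Clay (continuum YM on T⁴ ⇐
BetaPertH ∧ nine spine estimates).
-/

set_option autoImplicit false

namespace Summit.QuantumFields.BalabanUV.T4Continuum.NE7AxialGaugeDerivatives

open Literature.MathematicalPhysics.QuantumFieldTheory.Balaban1983to89
open B7Prop1Explicit
open NE7AxialRecursionLetters (seq_firstDiff_le seq_secondDiff_le)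
open NE7AxialGaugeLattice

/-! ## §1 Lattice bookkeeping: `NE7AxialGaugeLattice` (imported). -/


/-! ## §2 First differences -/

section Main

variable {d : ℕ} {𝔸 : Type*} [NormedRing 𝔸]
variable {y : Site d} {W : Site d → Fin d → 𝔸} {Q : Site d → Fin d → Fin d → 𝔸} {a p₁ p₂ : ℝ}

/-- **FIRST DIFFERENCES — the descending induction** (for the direction `ν`, levels `j = ν − i`): at every `x ∈ S_j` of the region `{y ≤ x, l1(x − y) ≤ S}` and
every difference direction `λ ≥ j`, `‖W(x + e_λ, ν) − W(x, ν)‖ ≤ i·(S·p₁ + a)`. [folklore] -/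
theorem firstDiff_induction {S : ℕ}
    (hW1 : ∀ x μ, ‖W x μ‖ ≤ 1) (hQ1 : ∀ x j ν, ‖Q x j ν‖ ≤ 1)
    (hT : ∀ (x : Site d) (j : Fin d), (∀ κ : Fin d, κ < j → x κ = y κ) → W x j = 1)
    (hRec : ∀ (x : Site d) (j ν : Fin d), j < ν → (∀ κ : Fin d, κ < j → x κ = y κ) → W (x + e j) ν = Q x j ν * W x ν)
    (ha : 0 ≤ a) (hp₁ : 0 ≤ p₁)
    (hQ0 : ∀ x : Site d, y ≤ x → l1 (x - y) ≤ S → ∀ j ν : Fin d, j < ν → ‖Q x j ν - 1‖ ≤ a)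
    (hQd : ∀ x : Site d, y ≤ x → l1 (x - y) ≤ S → ∀ lam j ν : Fin d, j < ν → ‖Q (x + e lam) j ν - Q x j ν‖ ≤ p₁)
    (ν : Fin d) :
    ∀ i j : ℕ, j + i = ν.val → ∀ x : Site d, y ≤ x → l1 (x - y) ≤ S → (∀ κ : Fin d, κ.val < j → x κ = y κ) →
      ∀ lam : Fin d, j ≤ lam.val → ‖W (x + e lam) ν - W x ν‖ ≤ i * (S * p₁ + a) := by
  intro i
  induction i with
  | zero =>
    intro j hj x _ _ hxj lam hlam
    have hj' : j = ν.val := by omega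
    have h1 : W x ν = 1 := hT x ν (fun κ hκ => hxj κ (by rw [hj']; exact Fin.lt_def.mp hκ))
    have h2 : W (x + e lam) ν = 1 := hT (x + e lam) ν (fun κ hκ => by
      have hκν : κ.val < ν.val := Fin.lt_def.mp hκ
      have hκlam : κ ≠ lam := fun h => by rw [h] at hκν; omega
      rw [add_e_apply_of_ne x hκlam]; exact hxj κ (by rw [hj']; exact hκν))
    rw [h1, h2, sub_self, norm_zero]; simp
  | succ i ih =>
    intro j hj x hyx hxS hxj lam hlam
    have hjν : j < ν.val := by omega
    have hjd : j < d := lt_trans hjν ν.isLt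
    -- the direction `j` as an element of `Fin d`
    obtain ⟨j', hj'v⟩ : ∃ j' : Fin d, j'.val = j := ⟨⟨j, hjd⟩, rfl⟩
    have hj'ν : j' < ν := Fin.lt_def.mpr (by rw [hj'v]; exact hjν)
    have hxj' : ∀ κ : Fin d, κ < j' → x κ = y κ := fun κ hκ => hxj κ (by rw [← hj'v]; exact Fin.lt_def.mp hκ)
    have hSp : 0 ≤ (S : ℝ) * p₁ := by positivity
    have hi0 : 0 ≤ (i : ℝ) * (S * p₁ + a) := by positivity
    by_cases hlj : lam = j'
    · -- the recursion itself: `W(x + e_j) − W(x) = (Q(x) − 1)·W(x)`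
      rw [hlj, hRec x j' ν hj'ν hxj']
      have hid : Q x j' ν * W x ν - W x ν = (Q x j' ν - 1) * W x ν := by noncomm_ring
      rw [hid]
      calc _ ≤ ‖Q x j' ν - 1‖ * ‖W x ν‖ := norm_mul_le _ _
        _ ≤ a * 1 := mul_le_mul (hQ0 x hyx hxS j' ν hj'ν) (hW1 x ν) (norm_nonneg _) ha
        _ ≤ ((i + 1 : ℕ) : ℝ) * (S * p₁ + a) := by push_cast; nlinarith
    · -- the segment from the foot `x* ∈ S_{j+1}` up to `x`
      have hlam' : j + 1 ≤ lam.val := by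
        rcases Nat.lt_or_ge j lam.val with h | h
        · omega
        · exact absurd (Fin.ext (by omega)) hlj
      set m : ℕ := (x j' - y j').toNat with hm
      obtain ⟨xs, hxs⟩ : ∃ xs : Site d, xs = x - ((m : ℕ) : ℤ) • e j' := ⟨_, rfl⟩
      obtain ⟨hyxs, hxsx, hxsj, hxsne, hxsm⟩ := foot_spec hyx j'
      rw [← hm, ← hxs] at hyxs hxsx hxsj hxsne hxsm
      have hxsS : l1 (xs - y) ≤ S :=
        (l1_sub_mono hyxs hxsx).trans hxS
      have hxs_strat : ∀ κ : Fin d, κ.val < j + 1 → xs κ = y κ := fun κ hκ => by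
        by_cases hκj : κ = j'
        · rw [hκj, hxsj]
        · rw [hxsne κ hκj]; exact hxj κ (by have : κ.val ≠ j := fun h => hκj (Fin.ext (by rw [h, hj'v])); omega)
      -- the segment points `z_t = xs + t·e_j`, `t ≤ m`
      have hz : ∀ t : ℕ, t ≤ m → y ≤ xs + ((t : ℕ) : ℤ) • e j' ∧ l1 (xs + ((t : ℕ) : ℤ) • e j' - y) ≤ S ∧
          ∀ κ : Fin d, κ < j' → (xs + ((t : ℕ) : ℤ) • e j') κ = y κ := by
        intro t ht
        obtain ⟨h1, h2⟩ := seg_point_spec hyx j' (t := t) (by rw [← hm]; exact ht)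
        rw [← hm, ← hxs] at h1 h2
        refine ⟨h1, (l1_sub_mono h1 h2).trans hxS, fun κ hκ => ?_⟩
        have hκj : κ ≠ j' := ne_of_lt hκ
        rw [add_zsmul_e_apply_of_ne _ hκj, hxsne κ hκj]
        exact hxj' κ hκ
      have hzlam : ∀ t : ℕ, t ≤ m → ∀ κ : Fin d, κ < j' → (xs + ((t : ℕ) : ℤ) • e j' + e lam) κ = y κ := by
        intro t ht κ hκ
        have hκlam : κ ≠ lam := fun h => by
          have := Fin.lt_def.mp hκ; rw [h, hj'v] at this; omega
        rw [add_e_apply_of_ne _ hκlam]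
        exact (hz t ht).2.2 κ hκ
      -- F1's first-difference letter along the segment
      have hseq := seq_firstDiff_le (𝔸 := 𝔸) (m := m) (p₁ := p₁)
        (g := fun t => W (xs + ((t : ℕ) : ℤ) • e j') ν) (g' := fun t => W (xs + ((t : ℕ) : ℤ) • e j' + e lam) ν)
        (P := fun t => Q (xs + ((t : ℕ) : ℤ) • e j') j' ν) (P' := fun t => Q (xs + ((t : ℕ) : ℤ) • e j' + e lam) j' ν)
        (fun t ht => by
          show W (xs + (((t + 1 : ℕ) : ℤ)) • e j') ν = _
          rw [add_natCast_succ_zsmul]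
          exact hRec _ j' ν hj'ν (hz t ht.le).2.2)
        (fun t ht => by
          show W (xs + (((t + 1 : ℕ) : ℤ)) • e j' + e lam) ν = _
          rw [add_natCast_succ_zsmul, add_right_comm]
          exact hRec _ j' ν hj'ν (hzlam t ht.le))
        (fun t _ => hQ1 _ j' ν) (fun t _ => hW1 _ ν)
        (fun t ht => hQd _ (hz t ht.le).1 (hz t ht.le).2.1 lam j' ν hj'ν)
        m le_rfl
      -- read at `t = m` (`z_m = x`) and at `t = 0` (`z_0 = xs`, induction hypothesis at level `j + 1`)
      simp only [Nat.cast_zero, zero_smul, add_zero] at hseq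
      rw [hxsm] at hseq
      have hih : ‖W (xs + e lam) ν - W xs ν‖ ≤ i * (S * p₁ + a) := ih (j + 1) (by omega) xs hyxs hxsS hxs_strat lam hlam'
      have hmS : (m : ℝ) ≤ S := by
        have h1 : m ≤ l1 (x - y) := by
          have := toNat_coord_le_l1 (sub_nonneg.mpr hyx) j'
          simpa [hm] using this
        exact_mod_cast h1.trans hxS
      calc ‖W (x + e lam) ν - W x ν‖ ≤ ‖W (xs + e lam) ν - W xs ν‖ + m * p₁ := hseq
        _ ≤ i * (S * p₁ + a) + S * p₁ := add_le_add hih (mul_le_mul_of_nonneg_right hmS hp₁)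
        _ ≤ ((i + 1 : ℕ) : ℝ) * (S * p₁ + a) := by push_cast; nlinarith

/-- **FIRST DIFFERENCES OF THE AXIAL BOND VARIABLES**: on the region `{y ≤ x, l1(x − y) ≤ S}`, for all directions `ν, λ`:
`‖W(x + e_λ, ν) − W(x, ν)‖ ≤ d·(S·p₁ + a)`. [folklore] -/
theorem norm_firstDiff_le {S : ℕ}
    (hW1 : ∀ x μ, ‖W x μ‖ ≤ 1) (hQ1 : ∀ x j ν, ‖Q x j ν‖ ≤ 1)
    (hT : ∀ (x : Site d) (j : Fin d), (∀ κ : Fin d, κ < j → x κ = y κ) → W x j = 1)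
    (hRec : ∀ (x : Site d) (j ν : Fin d), j < ν → (∀ κ : Fin d, κ < j → x κ = y κ) → W (x + e j) ν = Q x j ν * W x ν)
    (ha : 0 ≤ a) (hp₁ : 0 ≤ p₁)
    (hQ0 : ∀ x : Site d, y ≤ x → l1 (x - y) ≤ S → ∀ j ν : Fin d, j < ν → ‖Q x j ν - 1‖ ≤ a)
    (hQd : ∀ x : Site d, y ≤ x → l1 (x - y) ≤ S → ∀ lam j ν : Fin d, j < ν → ‖Q (x + e lam) j ν - Q x j ν‖ ≤ p₁)
    {x : Site d} (hyx : y ≤ x) (hxS : l1 (x - y) ≤ S) (ν lam : Fin d) :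
    ‖W (x + e lam) ν - W x ν‖ ≤ d * (S * p₁ + a) := by
  have h := firstDiff_induction hW1 hQ1 hT hRec ha hp₁ hQ0 hQd ν ν.val 0 (by simp) x hyx hxS (fun κ hκ => absurd hκ (Nat.not_lt_zero _))
    lam (Nat.zero_le _)
  refine h.trans (mul_le_mul_of_nonneg_right ?_ (by positivity))
  exact_mod_cast ν.isLt.le

/-! ## §3 Second differences -/

/-- **SECOND DIFFERENCES — the descending induction** (direction `ν`, levels `j = ν − i`; `δ` = a first-difference bound on the region of radius `R + 1`):
at every `x ∈ S_j` with `y ≤ x`, `l1(x − y) ≤ R` and all `λ, λ′ ≥ j`, `‖Δ_λΔ_λ′ W(·, ν)(x)‖ ≤ i·(R·(p₂ + 2p₁δ) + (p₁ + aδ))`. [folklore] -/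
theorem secondDiff_induction {R : ℕ} {δ : ℝ}
    (hW1 : ∀ x μ, ‖W x μ‖ ≤ 1) (hQ1 : ∀ x j ν, ‖Q x j ν‖ ≤ 1)
    (hT : ∀ (x : Site d) (j : Fin d), (∀ κ : Fin d, κ < j → x κ = y κ) → W x j = 1)
    (hRec : ∀ (x : Site d) (j ν : Fin d), j < ν → (∀ κ : Fin d, κ < j → x κ = y κ) → W (x + e j) ν = Q x j ν * W x ν)
    (ha : 0 ≤ a) (hp₁ : 0 ≤ p₁) (hp₂ : 0 ≤ p₂) (hδ : 0 ≤ δ)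
    (hQ0 : ∀ x : Site d, y ≤ x → l1 (x - y) ≤ R + 1 → ∀ j ν : Fin d, j < ν → ‖Q x j ν - 1‖ ≤ a)
    (hQd : ∀ x : Site d, y ≤ x → l1 (x - y) ≤ R + 1 → ∀ lam j ν : Fin d, j < ν → ‖Q (x + e lam) j ν - Q x j ν‖ ≤ p₁)
    (hQ2 : ∀ x : Site d, y ≤ x → l1 (x - y) ≤ R → ∀ lam lam' j ν : Fin d, j < ν →
      ‖Q (x + e lam + e lam') j ν - Q (x + e lam) j ν - Q (x + e lam') j ν + Q x j ν‖ ≤ p₂)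
    (hfirst : ∀ x : Site d, y ≤ x → l1 (x - y) ≤ R + 1 → ∀ ν lam : Fin d, ‖W (x + e lam) ν - W x ν‖ ≤ δ)
    (ν : Fin d) :
    ∀ i j : ℕ, j + i = ν.val → ∀ x : Site d, y ≤ x → l1 (x - y) ≤ R → (∀ κ : Fin d, κ.val < j → x κ = y κ) →
      ∀ lam lam' : Fin d, j ≤ lam.val → j ≤ lam'.val →
        ‖W (x + e lam + e lam') ν - W (x + e lam) ν - W (x + e lam') ν + W x ν‖ ≤ i * (R * (p₂ + 2 * p₁ * δ) + (p₁ + a * δ)) := by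
  intro i
  induction i with
  | zero =>
    intro j hj x _ _ hxj lam lam' hlam hlam'
    have hj' : j = ν.val := by omega
    -- on `S_ν` every bond in direction `ν` carries `1`
    have hone : ∀ z : Site d, (∀ κ : Fin d, κ.val < ν.val → z κ = y κ) → W z ν = 1 :=
      fun z hz => hT z ν (fun κ hκ => hz κ (Fin.lt_def.mp hκ))
    have hx' : ∀ κ : Fin d, κ.val < ν.val → x κ = y κ := fun κ hκ => hxj κ (by rw [hj']; exact hκ)
    have hsh : ∀ (z : Site d) (μ : Fin d), j ≤ μ.val → (∀ κ : Fin d, κ.val < ν.val → z κ = y κ) →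
        ∀ κ : Fin d, κ.val < ν.val → (z + e μ) κ = y κ := by
      intro z μ hμ hz κ hκ
      have hκμ : κ ≠ μ := fun h => by rw [h] at hκ; omega
      rw [add_e_apply_of_ne z hκμ]; exact hz κ hκ
    rw [hone x hx', hone _ (hsh x lam hlam hx'), hone _ (hsh x lam' hlam' hx'), hone _ (hsh _ lam' hlam' (hsh x lam hlam hx'))]
    simp
  | succ i ih =>
    intro j hj x hyx hxR hxj lam lam' hlam hlam'
    have hjν : j < ν.val := by omega
    have hjd : j < d := lt_trans hjν ν.isLt
    obtain ⟨j', hj'v⟩ : ∃ j' : Fin d, j'.val = j := ⟨⟨j, hjd⟩, rfl⟩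
    have hj'ν : j' < ν := Fin.lt_def.mpr (by rw [hj'v]; exact hjν)
    have hxj' : ∀ κ : Fin d, κ < j' → x κ = y κ := fun κ hκ => hxj κ (by rw [← hj'v]; exact Fin.lt_def.mp hκ)
    have hxR1 : l1 (x - y) ≤ R + 1 := hxR.trans (Nat.le_succ _)
    have hK0 : 0 ≤ (R : ℝ) * (p₂ + 2 * p₁ * δ) := by positivity
    have hi0 : 0 ≤ (i : ℝ) * (R * (p₂ + 2 * p₁ * δ) + (p₁ + a * δ)) := by positivity
    -- translates by a direction `μ ≥ j` stay on `S_j`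
    have hshift : ∀ (z : Site d) (μ : Fin d), j ≤ μ.val → (∀ κ : Fin d, κ < j' → z κ = y κ) →
        ∀ κ : Fin d, κ < j' → (z + e μ) κ = y κ := by
      intro z μ hμ hz κ hκ
      have hκμ : κ ≠ μ := fun h => by have := Fin.lt_def.mp hκ; rw [h, hj'v] at this; omega
      rw [add_e_apply_of_ne z hκμ]; exact hz κ hκ
    -- THE DIRECT CASE `λ = j` (any `λ′ ≥ j`): `Δ_jΔ_λ′W(x) = (Q(x + e_λ′) − Q(x))·W(x + e_λ′) + (Q(x) − 1)·(W(x + e_λ′) − W(x))`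
    have hdirect : ∀ μ : Fin d, j ≤ μ.val →
        ‖W (x + e j' + e μ) ν - W (x + e j') ν - W (x + e μ) ν + W x ν‖ ≤ p₁ + a * δ := by
      intro μ hμ
      have h1 : W (x + e j') ν = Q x j' ν * W x ν := hRec x j' ν hj'ν hxj'
      have h2 : W (x + e j' + e μ) ν = Q (x + e μ) j' ν * W (x + e μ) ν := by
        rw [add_right_comm]; exact hRec (x + e μ) j' ν hj'ν (hshift x μ hμ hxj')
      have hid : W (x + e j' + e μ) ν - W (x + e j') ν - W (x + e μ) ν + W x ν
          = (Q (x + e μ) j' ν - Q x j' ν) * W (x + e μ) ν + (Q x j' ν - 1) * (W (x + e μ) ν - W x ν) := by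
        rw [h1, h2]; noncomm_ring
      rw [hid]
      have t1 : ‖(Q (x + e μ) j' ν - Q x j' ν) * W (x + e μ) ν‖ ≤ p₁ := by
        refine (norm_mul_le _ _).trans ?_
        calc _ ≤ p₁ * 1 := mul_le_mul (hQd x hyx hxR1 μ j' ν hj'ν) (hW1 _ ν) (norm_nonneg _) hp₁
          _ = p₁ := mul_one _
      have t2 : ‖(Q x j' ν - 1) * (W (x + e μ) ν - W x ν)‖ ≤ a * δ :=
        (norm_mul_le _ _).trans (mul_le_mul (hQ0 x hyx hxR1 j' ν hj'ν) (hfirst x hyx hxR1 ν μ) (norm_nonneg _) ha)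
      exact (norm_add_le _ _).trans (add_le_add t1 t2)
    have hgoal_of_direct : p₁ + a * δ ≤ ((i + 1 : ℕ) : ℝ) * (R * (p₂ + 2 * p₁ * δ) + (p₁ + a * δ)) := by
      push_cast; nlinarith
    by_cases hlj : lam = j'
    · rw [hlj]; exact (hdirect lam' hlam').trans hgoal_of_direct
    by_cases hlj' : lam' = j'
    · -- symmetric to the direct case
      rw [hlj', add_right_comm x (e lam) (e j'),
        show W (x + e j' + e lam) ν - W (x + e lam) ν - W (x + e j') ν + W x ν
          = W (x + e j' + e lam) ν - W (x + e j') ν - W (x + e lam) ν + W x ν by abel]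
      exact (hdirect lam hlam).trans hgoal_of_direct
    -- THE SEGMENT CASE `λ, λ′ > j`
    have hlam1 : j + 1 ≤ lam.val := by
      rcases Nat.lt_or_ge j lam.val with h | h
      · omega
      · exact absurd (Fin.ext (by omega)) hlj
    have hlam1' : j + 1 ≤ lam'.val := by
      rcases Nat.lt_or_ge j lam'.val with h | h
      · omega
      · exact absurd (Fin.ext (by omega)) hlj'
    set m : ℕ := (x j' - y j').toNat with hm
    obtain ⟨xs, hxs⟩ : ∃ xs : Site d, xs = x - ((m : ℕ) : ℤ) • e j' := ⟨_, rfl⟩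
    obtain ⟨hyxs, hxsx, hxsj, hxsne, hxsm⟩ := foot_spec hyx j'
    rw [← hm, ← hxs] at hyxs hxsx hxsj hxsne hxsm
    have hxsR : l1 (xs - y) ≤ R :=
      (l1_sub_mono hyxs hxsx).trans hxR
    have hxs_strat : ∀ κ : Fin d, κ.val < j + 1 → xs κ = y κ := fun κ hκ => by
      by_cases hκj : κ = j'
      · rw [hκj, hxsj]
      · rw [hxsne κ hκj]; exact hxj κ (by have : κ.val ≠ j := fun h => hκj (Fin.ext (by rw [h, hj'v])); omega)
    have hz : ∀ t : ℕ, t ≤ m → y ≤ xs + ((t : ℕ) : ℤ) • e j' ∧ l1 (xs + ((t : ℕ) : ℤ) • e j' - y) ≤ R ∧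
        ∀ κ : Fin d, κ < j' → (xs + ((t : ℕ) : ℤ) • e j') κ = y κ := by
      intro t ht
      obtain ⟨h1, h2⟩ := seg_point_spec hyx j' (t := t) (by rw [← hm]; exact ht)
      rw [← hm, ← hxs] at h1 h2
      refine ⟨h1, (l1_sub_mono h1 h2).trans hxR, fun κ hκ => ?_⟩
      have hκj : κ ≠ j' := ne_of_lt hκ
      rw [add_zsmul_e_apply_of_ne _ hκj, hxsne κ hκj]
      exact hxj' κ hκ
    -- the translate `z_t + e_λ` lies in the region of radius `R + 1`
    have hzsh : ∀ t : ℕ, t ≤ m → ∀ μ : Fin d, y ≤ xs + ((t : ℕ) : ℤ) • e j' + e μ ∧ l1 (xs + ((t : ℕ) : ℤ) • e j' + e μ - y) ≤ R + 1 := by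
      intro t ht μ
      obtain ⟨h1, h2, -⟩ := hz t ht
      have hA : ∀ κ : Fin d, y κ ≤ (xs + ((t : ℕ) : ℤ) • e j' + e μ) κ := by
        intro κ
        by_cases hκ : κ = μ
        · have h1κ : y μ ≤ (xs + ((t : ℕ) : ℤ) • e j') μ := h1 μ
          have hsh : (xs + ((t : ℕ) : ℤ) • e j' + e μ) μ = (xs + ((t : ℕ) : ℤ) • e j') μ + 1 := by
            rw [Pi.add_apply, e_apply, if_pos rfl]
          rw [hκ, hsh]; omega
        · rw [add_e_apply_of_ne _ hκ]; exact h1 κ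
      refine ⟨hA, ?_⟩
      · have e1 : xs + ((t : ℕ) : ℤ) • e j' + e μ - y = (xs + ((t : ℕ) : ℤ) • e j' - y) + e μ := by abel
        rw [e1]
        exact (l1_add_e_le _ μ).trans (by omega)
    -- F1's second-difference letter along the segment
    have hseq := seq_secondDiff_le (𝔸 := 𝔸) (m := m) (p₂ := p₂) (ph := p₁) (pv := p₁) (dh := δ) (dv := δ)
      (g₀₀ := fun t => W (xs + ((t : ℕ) : ℤ) • e j') ν) (g₁₀ := fun t => W (xs + ((t : ℕ) : ℤ) • e j' + e lam) ν)
      (g₀₁ := fun t => W (xs + ((t : ℕ) : ℤ) • e j' + e lam') ν) (g₁₁ := fun t => W (xs + ((t : ℕ) : ℤ) • e j' + e lam + e lam') ν)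
      (P₀₀ := fun t => Q (xs + ((t : ℕ) : ℤ) • e j') j' ν) (P₁₀ := fun t => Q (xs + ((t : ℕ) : ℤ) • e j' + e lam) j' ν)
      (P₀₁ := fun t => Q (xs + ((t : ℕ) : ℤ) • e j' + e lam') j' ν) (P₁₁ := fun t => Q (xs + ((t : ℕ) : ℤ) • e j' + e lam + e lam') j' ν)
      (fun t ht => by
        show W (xs + (((t + 1 : ℕ) : ℤ)) • e j') ν = _
        rw [add_natCast_succ_zsmul]
        exact hRec _ j' ν hj'ν (hz t ht.le).2.2)
      (fun t ht => by
        show W (xs + (((t + 1 : ℕ) : ℤ)) • e j' + e lam) ν = _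
        rw [add_natCast_succ_zsmul, add_right_comm]
        exact hRec _ j' ν hj'ν (hshift _ lam hlam (hz t ht.le).2.2))
      (fun t ht => by
        show W (xs + (((t + 1 : ℕ) : ℤ)) • e j' + e lam') ν = _
        rw [add_natCast_succ_zsmul, add_right_comm]
        exact hRec _ j' ν hj'ν (hshift _ lam' hlam' (hz t ht.le).2.2))
      (fun t ht => by
        show W (xs + (((t + 1 : ℕ) : ℤ)) • e j' + e lam + e lam') ν = _
        rw [add_natCast_succ_zsmul, add_right_comm _ (e j') (e lam), add_right_comm _ (e j') (e lam')]
        exact hRec _ j' ν hj'ν (hshift _ lam' hlam' (hshift _ lam hlam (hz t ht.le).2.2)))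
      (fun t _ => hQ1 _ j' ν) (fun t _ => hW1 _ ν)
      (fun t ht => hQ2 _ (hz t ht.le).1 (hz t ht.le).2.1 lam lam' j' ν hj'ν)
      (fun t ht => hQd _ (hz t ht.le).1 ((hz t ht.le).2.1.trans (Nat.le_succ _)) lam j' ν hj'ν)
      (fun t ht => hQd _ (hz t ht.le).1 ((hz t ht.le).2.1.trans (Nat.le_succ _)) lam' j' ν hj'ν)
      (fun t ht => by
        show ‖W (xs + ((t : ℕ) : ℤ) • e j' + e lam + e lam') ν - W (xs + ((t : ℕ) : ℤ) • e j' + e lam) ν‖ ≤ δ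
        exact hfirst _ (hzsh t ht.le lam).1 (hzsh t ht.le lam).2 ν lam')
      (fun t ht => by
        show ‖W (xs + ((t : ℕ) : ℤ) • e j' + e lam + e lam') ν - W (xs + ((t : ℕ) : ℤ) • e j' + e lam') ν‖ ≤ δ
        rw [add_right_comm _ (e lam) (e lam')]
        exact hfirst _ (hzsh t ht.le lam').1 (hzsh t ht.le lam').2 ν lam)
      m le_rfl
    simp only [Nat.cast_zero, zero_smul, add_zero] at hseq
    rw [hxsm] at hseq
    have hih : ‖W (xs + e lam + e lam') ν - W (xs + e lam) ν - W (xs + e lam') ν + W xs ν‖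
        ≤ i * (R * (p₂ + 2 * p₁ * δ) + (p₁ + a * δ)) :=
      ih (j + 1) (by omega) xs hyxs hxsR hxs_strat lam lam' hlam1 hlam1'
    have hmR : (m : ℝ) ≤ R := by
      have h1 : m ≤ l1 (x - y) := by
        have := toNat_coord_le_l1 (sub_nonneg.mpr hyx) j'
        simpa [hm] using this
      exact_mod_cast h1.trans hxR
    have hstep0 : 0 ≤ p₂ + p₁ * δ + p₁ * δ := by positivity
    calc ‖W (x + e lam + e lam') ν - W (x + e lam) ν - W (x + e lam') ν + W x ν‖
        ≤ ‖W (xs + e lam + e lam') ν - W (xs + e lam) ν - W (xs + e lam') ν + W xs ν‖ + m * (p₂ + p₁ * δ + p₁ * δ) := hseq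
      _ ≤ i * (R * (p₂ + 2 * p₁ * δ) + (p₁ + a * δ)) + R * (p₂ + p₁ * δ + p₁ * δ) :=
          add_le_add hih (mul_le_mul_of_nonneg_right hmR hstep0)
      _ ≤ ((i + 1 : ℕ) : ℝ) * (R * (p₂ + 2 * p₁ * δ) + (p₁ + a * δ)) := by push_cast; nlinarith

/-- **SECOND DIFFERENCES OF THE AXIAL BOND VARIABLES**: on the region `{y ≤ x, l1(x − y) ≤ R}`, with the plaquette letters on the region of radius `R + 1`
and a first-difference bound `δ` there, for all directions `ν, λ, λ′`:
`‖W(x + e_λ + e_λ′, ν) − W(x + e_λ, ν) − W(x + e_λ′, ν) + W(x, ν)‖ ≤ d·(R·(p₂ + 2p₁δ) + p₁ + aδ)`. [folklore] -/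
theorem norm_secondDiff_le {R : ℕ} {δ : ℝ}
    (hW1 : ∀ x μ, ‖W x μ‖ ≤ 1) (hQ1 : ∀ x j ν, ‖Q x j ν‖ ≤ 1)
    (hT : ∀ (x : Site d) (j : Fin d), (∀ κ : Fin d, κ < j → x κ = y κ) → W x j = 1)
    (hRec : ∀ (x : Site d) (j ν : Fin d), j < ν → (∀ κ : Fin d, κ < j → x κ = y κ) → W (x + e j) ν = Q x j ν * W x ν)
    (ha : 0 ≤ a) (hp₁ : 0 ≤ p₁) (hp₂ : 0 ≤ p₂) (hδ : 0 ≤ δ)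
    (hQ0 : ∀ x : Site d, y ≤ x → l1 (x - y) ≤ R + 1 → ∀ j ν : Fin d, j < ν → ‖Q x j ν - 1‖ ≤ a)
    (hQd : ∀ x : Site d, y ≤ x → l1 (x - y) ≤ R + 1 → ∀ lam j ν : Fin d, j < ν → ‖Q (x + e lam) j ν - Q x j ν‖ ≤ p₁)
    (hQ2 : ∀ x : Site d, y ≤ x → l1 (x - y) ≤ R → ∀ lam lam' j ν : Fin d, j < ν →
      ‖Q (x + e lam + e lam') j ν - Q (x + e lam) j ν - Q (x + e lam') j ν + Q x j ν‖ ≤ p₂)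
    (hfirst : ∀ x : Site d, y ≤ x → l1 (x - y) ≤ R + 1 → ∀ ν lam : Fin d, ‖W (x + e lam) ν - W x ν‖ ≤ δ)
    {x : Site d} (hyx : y ≤ x) (hxR : l1 (x - y) ≤ R) (ν lam lam' : Fin d) :
    ‖W (x + e lam + e lam') ν - W (x + e lam) ν - W (x + e lam') ν + W x ν‖ ≤ d * (R * (p₂ + 2 * p₁ * δ) + (p₁ + a * δ)) := by
  have h := secondDiff_induction hW1 hQ1 hT hRec ha hp₁ hp₂ hδ hQ0 hQd hQ2 hfirst ν ν.val 0 (by simp) x hyx hxR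
    (fun κ hκ => absurd hκ (Nat.not_lt_zero _)) lam lam' (Nat.zero_le _) (Nat.zero_le _)
  refine h.trans (mul_le_mul_of_nonneg_right ?_ (by positivity))
  exact_mod_cast ν.isLt.le

end Main

end Summit.QuantumFields.BalabanUV.T4Continuum.NE7AxialGaugeDerivatives
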